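import Summits.ResolutionOfSingularities.ResolutionOfSingularities.Theorems.WeightedInvariantIota3DominanceWord
import Summits.ResolutionOfSingularities.ResolutionOfSingularities.Theorems.WeightedInvariantKeyRungThreeOfPresDrop
import HarnessLib

/-!
# CLOSURES BY NAME after LEMMA C′: (INV)₃, (IDLexact)₃, (σ-ext), GAP 2 unconditional; the rung clauses (c10)≤3, (c11)≤3 for the pair
# `(ι₃ᵗ, J₃ᵗ)` from (desc-τ) alone; the graded HOM rung `PRungGrHomLE 3 p ι₃ᵗ J₃ᵗ` from (desc-τ) and hgame
# (door `HypersurfaceCentreConstruction`, stmt-ResolutionOfSingularities-19897)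

Helper for `stub_keyRungGrHomLE_three` (def-free, `--supports 19897`).  The gap-list chain of hands -4 and -5 (…KeyRungThreeOfSigmaExt →
…SigmaExtDimTwo → …SigmaExtLevelDescent → …SigmaIdealDescent → …JSigmaPtMapOfExactIdealDescent → …IdealDescentExactR6Pos → …RatioLetterExact →
…IdealDescentOfInvariance) reduced (σ-ext) and GAP 2 to the invariance (INV)₃, which is now a theorem (`Iota3.levels_le_of_ratioMax`,
…Iota3SecondMemberDominance).  Composing the step lemmas BY NAME:
* `invariance3_holds` ((INV)₃ in the chain's binder shape), `idealDescentExact3_holds` ((IDLexact)₃, `FibreDescent.idealDescentExact3_of_invariance`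
  + (RAD)₃ `FibreDescent.isRadical_map_maximalIdeal_tensor`), **`sigmaExt_holds`** ((σ-ext): `σ` is invariant along `𝔪`-preserving local formally
  smooth essentially-of-finite-type maps of regular local rings into dimension `≤ 3`), **`jSigmaPt_map_holds`** (GAP 2);
* **`iotaJEssSmoothCompatibleLE_three_of_tieDescent (hD) : IotaJEssSmoothCompatibleLE 3 iotaFlatT jFlatT`** ((c11)≤3 ⟸ (desc-τ));
* **`iotaFlatT_torusFactorMonotoneLE_three_of_tieDescent (hD) : IotaTorusFactorMonotoneLE 3 p iotaFlatT`** ((c10)≤3 ⟸ (desc-τ));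
* **`pRungGrHomLE_three_of_tieDescent_game (hD) (hgame) : PRungGrHomLE 3 p iotaFlatT jFlatT`** — the graded HOM rung FOR THE NAMED PAIR from
  (desc-τ) and hgame (all other clauses are tree theorems: (c6) (c7) (c8) (c5) (open″) (c12) (c8-gr)).
[OURS · L1 W4.3 · audit glue; AI work, weaker than expert review; nothing here is a statement of the manuscript under review.]
-/

noncomputable section

set_option linter.dupNamespace false -- mandated namespace of this single-conjunct summit

open IsLocalRing Literature.AlgebraicGeometry.Resolution Polynomial
open Summit.ResolutionOfSingularities.ResolutionOfSingularities.Theorems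
open Summit.ResolutionOfSingularities.ResolutionOfSingularities.Theorems.ContactCylinder

namespace Summit.ResolutionOfSingularities.ResolutionOfSingularities.Cruxes.HypersurfaceCentreConstruction.LocalEngine

namespace Iota3

/-- **(INV)₃ in the binder shape of the gap-list chain** (`levels_le_of_ratioMax`). [OURS · L1 W4.3] -/
theorem invariance3_holds :
    ∀ (A : Type) [CommRing A] [IsRegularLocalRing A] (g : A), ringKrullDim A = (3 : ℕ) → g ≠ 0 → g ∈ maximalIdeal A →
      ∀ (g₁ g₂ g₁' g₂' : A) (q r₁ r₂ : ℕ), IsTwoFlag g₁ g₂ → IsTwoFlag g₁' g₂' → AdmissibleTriple q r₁ r₂ → q < r₂ →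
      g ∈ flagContactFiltration g₁ g₂ q r₁ r₂ (r₁ * (adicOrder g).toNat) →
      g ∈ flagContactFiltration g₁' g₂' q r₁ r₂ (r₁ * (adicOrder g).toNat) →
      (∀ q' r₁' r₂' : ℕ, AdmissibleTriple q' r₁' r₂' → FlagReaches g (adicOrder g).toNat q' r₁' r₂' → r₁' * r₂ ≤ r₁ * r₂') →
      flagContactFiltration g₁' g₂' q r₁ r₂ r₁ ≤ flagContactFiltration g₁ g₂ q r₁ r₂ r₁ ∧
        flagContactFiltration g₁' g₂' q r₁ r₂ r₂ ≤ flagContactFiltration g₁ g₂ q r₁ r₂ r₂ :=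
  fun _ _ _ _ hdim hg0 hgm _ _ _ _ _ _ _ hΦ hΦ' hadm hq₂ hF hF' hmax =>
    levels_le_of_ratioMax hdim hg0 hgm hΦ hΦ' hadm hq₂ hF hF' hmax

/-- **(IDLexact)₃ UNCONDITIONAL**: the two filtration levels of a two-flag of `T'` reaching the maximal-ratio triple for `φ g` are
extended from ideals of `T`, along every `𝔪`-preserving local formally smooth e.f.t. `T → T'` of regular local rings of dimension three
(`FibreDescent.idealDescentExact3_of_invariance` + (INV)₃ + (RAD)₃). [OURS · L1 W4.3] -/
theorem idealDescentExact3_holds :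
    ∀ (T T' : Type) [CommRing T] [IsRegularLocalRing T] [CommRing T'] [IsRegularLocalRing T'] [Algebra T T']
      [IsLocalHom (algebraMap T T')] [Algebra.FormallySmooth T T'] [Algebra.EssFiniteType T T'] (g : T),
      ringKrullDim T = (3 : ℕ) → ringKrullDim T' = (3 : ℕ) → (maximalIdeal T).map (algebraMap T T') = maximalIdeal T' →
      g ≠ 0 → g ∈ maximalIdeal T → ∀ (g₁' g₂' : T') (q r₁ r₂ : ℕ), IsTwoFlag g₁' g₂' → AdmissibleTriple q r₁ r₂ → q < r₂ →
      algebraMap T T' g ∈ flagContactFiltration g₁' g₂' q r₁ r₂ (r₁ * (adicOrder g).toNat) →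
      (∀ q' r₁' r₂' : ℕ, AdmissibleTriple q' r₁' r₂' → FlagReaches (algebraMap T T' g) (adicOrder g).toNat q' r₁' r₂' →
        r₁' * r₂ ≤ r₁ * r₂') →
      ∃ J₁ J₂ : Ideal T, J₁.map (algebraMap T T') = flagContactFiltration g₁' g₂' q r₁ r₂ r₁ ∧
        J₂.map (algebraMap T T') = flagContactFiltration g₁' g₂' q r₁ r₂ r₂ :=
  fun T T' _ _ _ _ _ _ _ _ g hdim hdim' hm hg0 hg g₁' g₂' q r₁ r₂ hfl hadm hq hreach hexact =>
    FibreDescent.idealDescentExact3_of_invariance invariance3_holds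
      (fun T T' _ _ _ _ _ _ _ _ _ _ _ => FibreDescent.isRadical_map_maximalIdeal_tensor T T')
      T T' g hdim hdim' hm hg0 hg g₁' g₂' q r₁ r₂ hfl hadm hq hreach hexact

/-- **(σ-ext) UNCONDITIONAL**: `σ(A', φ g) = σ(A, g)` for every `𝔪`-preserving local formally smooth essentially-of-finite-type `φ : A → A'`
of regular local rings with `dim A' ≤ 3`.  (`sigmaExt_of_sigmaExt_three` ∘ `sigmaExt_three_of_levelDescent` ∘ `levelDescent_three_of_idealDescent`
∘ `idealDescent_letter_of_exact_pos` with (IDLexact)₃ and the exact ratio letter (R6⁺)₃ `ratioScale_mul_le_sigmaRatioNat_mul`.) [OURS · L1 W4.3] -/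
theorem sigmaExt_holds :
    ∀ (A A' : Type) [CommRing A] [IsRegularLocalRing A] [CommRing A'] [IsRegularLocalRing A'] [Algebra A A']
      [IsLocalHom (algebraMap A A')] [Algebra.FormallySmooth A A'] [Algebra.EssFiniteType A A'] (g : A),
      ringKrullDim A' ≤ 3 → (maximalIdeal A).map (algebraMap A A') = maximalIdeal A' → iotaSigma A' (algebraMap A A' g) = iotaSigma A g :=
  sigmaExt_of_sigmaExt_three (sigmaExt_three_of_levelDescent (levelDescent_three_of_idealDescent
    (idealDescent_letter_of_exact_pos idealDescentExact3_holds
      (fun _ _ _ _ hd hf0 hf hσ _ _ _ hadm hreach => ratioScale_mul_le_sigmaRatioNat_mul hd hf0 hf hσ hadm hreach))))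

/-- **GAP 2 UNCONDITIONAL**: `jSigmaPt` commutes with `𝔪`-preserving local formally smooth e.f.t. maps at equal dimension three and `ε = 0`
(`gap2_of_exactIdealDescent` with (IDLexact)₃). [OURS · L1 W4.3] -/
theorem jSigmaPt_map_holds :
    ∀ (T T' : Type) [CommRing T] [IsRegularLocalRing T] [CommRing T'] [IsRegularLocalRing T'] [Algebra T T']
      [IsLocalHom (algebraMap T T')] [Algebra.FormallySmooth T T'] [Algebra.EssFiniteType T T'] (g : T),
      ringKrullDim T' ≤ 3 → (maximalIdeal T).map (algebraMap T T') = maximalIdeal T' → ringKrullDim T = (3 : ℕ) →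
      iotaEps T g = 0 → ∀ m : ℕ, jSigmaPt T' (algebraMap T T' g) m = (jSigmaPt T g m).map (algebraMap T T') :=
  gap2_of_exactIdealDescent idealDescentExact3_holds

/-- **(c11)≤3 FOR THE PAIR OF RECORD FROM (desc-τ) ALONE**: `IotaJEssSmoothCompatibleLE 3 iotaFlatT jFlatT`
(`iotaJEssSmoothCompatibleLE_three_of_sigmaExt` with (σ-ext) and GAP 2 discharged). [OURS · L1 W4.3] -/
theorem iotaJEssSmoothCompatibleLE_three_of_tieDescent
    (hD : ∀ (T T' : Type) [CommRing T] [IsRegularLocalRing T] [CommRing T'] [IsRegularLocalRing T'] [Algebra T T']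
      [IsLocalHom (algebraMap T T')] [Algebra.FormallySmooth T T'] [Algebra.EssFiniteType T T'] (g : T),
      ringKrullDim T' ≤ 3 → IsTiePosition T' (algebraMap T T' g) → IsTiePosition T g) :
    IotaJEssSmoothCompatibleLE 3 iotaFlatT jFlatT :=
  iotaJEssSmoothCompatibleLE_three_of_sigmaExt sigmaExt_holds hD jSigmaPt_map_holds

/-- **(c10)≤3 FOR THE PAIR OF RECORD FROM (desc-τ) ALONE**: `IotaTorusFactorMonotoneLE 3 p iotaFlatT`
(`iotaFlatT_torusFactorMonotoneLE_of_tauEssSmooth` with τ along ess. smooth maps from (desc-τ) and `σ` at the generic fibre from (σ-ext)).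
[OURS · L1 W4.3] -/
theorem iotaFlatT_torusFactorMonotoneLE_three_of_tieDescent
    (hD : ∀ (T T' : Type) [CommRing T] [IsRegularLocalRing T] [CommRing T'] [IsRegularLocalRing T'] [Algebra T T']
      [IsLocalHom (algebraMap T T')] [Algebra.FormallySmooth T T'] [Algebra.EssFiniteType T T'] (g : T),
      ringKrullDim T' ≤ 3 → IsTiePosition T' (algebraMap T T' g) → IsTiePosition T g) (p : ℕ) :
    IotaTorusFactorMonotoneLE 3 p iotaFlatT :=
  iotaFlatT_torusFactorMonotoneLE_of_tauEssSmooth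
    (fun T T' _ _ _ _ _ _ _ _ g hd => iotaTau_essSmooth_eq_of_descent hD T T' g hd) (sigma_genericFibre_le_of_sigmaExt sigmaExt_holds) p

end Iota3

open Iota3

/-- **THE GRADED HOM RUNG FOR THE NAMED PAIR `(ι₃ᵗ, J₃ᵗ)` FROM (desc-τ) AND hgame**: `PRungGrHomLE 3 p iotaFlatT jFlatT` — (c6) `iotaFlatT_isoInvariant`,
(c7) `iotaFlatT_generizationMonotoneLE`, (c8) `iotaFlatT_upperSemicontinuousLE_three`, (c10)/(c11) from (desc-τ) (this file), (c5) `jFlatT_isoInvariant`,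
(c9′-hom) = hgame, (open″) `jOpenPresentationForallSingLE_three` (…Iota3DominanceWord), (c12) unit invariance, (c8-gr) `iotaFlatT_upperSemicontinuousGradedLE_three`.
[OURS · L1 W4.3 · audit glue] -/
theorem pRungGrHomLE_three_of_tieDescent_game (p : ℕ)
    (hD : ∀ (T T' : Type) [CommRing T] [IsRegularLocalRing T] [CommRing T'] [IsRegularLocalRing T'] [Algebra T T']
      [IsLocalHom (algebraMap T T')] [Algebra.FormallySmooth T T'] [Algebra.EssFiniteType T T'] (g : T),
      ringKrullDim T' ≤ 3 → IsTiePosition T' (algebraMap T T' g) → IsTiePosition T g)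
    (hgame : CanonicalGameClauseHomLE 3 p iotaFlatT jFlatT) :
    PRungGrHomLE 3 p iotaFlatT jFlatT :=
  ⟨⟨iotaFlatT_isoInvariant, iotaFlatT_generizationMonotoneLE p, iotaFlatT_upperSemicontinuousLE_three p,
      iotaFlatT_torusFactorMonotoneLE_three_of_tieDescent hD p, jFlatT_isoInvariant, iotaJEssSmoothCompatibleLE_three_of_tieDescent hD, hgame,
      jOpenPresentationForallSingLE_three p, iotaFlatT_unitInvariant, jFlatT_unitInvariant⟩,
    iotaFlatT_upperSemicontinuousGradedLE_three p⟩

/-- **GAP LIST OF RECORD (named-pair form)**: `PRungGrHomLE 3 p iotaFlatT jFlatT` from hD (typing), (PRES)₃ and (DROP)₃ (see …KeyRungThreeOfPresDrop).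
[OURS · L1 W4.3 · audit glue] -/
theorem pRungGrHomLE_three_of_pres_drop (p : ℕ)
    (hD : ∀ (T T' : Type) [CommRing T] [IsRegularLocalRing T] [CommRing T'] [IsRegularLocalRing T'] [Algebra T T']
      [IsLocalHom (algebraMap T T')] [Algebra.FormallySmooth T T'] [Algebra.EssFiniteType T T'] (g : T),
      ringKrullDim T' ≤ 3 → IsTiePosition T' (algebraMap T T' g) → IsTiePosition T g)
    (hPRES : ∀ (k₀ : Type) [Field k₀] [CharP k₀ p] [PerfectField k₀]
      (S : Type) [CommRing S] [Algebra k₀ S] [Algebra.EssFiniteType k₀ S] [IsRegularLocalRing S]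
      (f : S), ringKrullDim S ≤ 3 → f ≠ 0 → f ∈ (maximalIdeal S) ^ 2 →
      ∀ (P : Ideal S) [P.IsPrime], IsRegularLocalRing (S ⧸ P) → f ∈ P →
        topStratum iotaOrdEpsTau S f = {𝔮 | P ≤ 𝔮.asIdeal} →
        ∃ (n : ℕ) (u : Fin n → S) (w : Fin n → ℕ),
          Ideal.span (Set.range u) = maximalIdeal S ∧ (maximalIdeal S).spanFinrank = n ∧ (∃ i, 0 < w i) ∧
          Ideal.span {x | ∃ i, 0 < w i ∧ x = u i} = P ∧
          (∀ m : ℕ, weightedMonomialIdeal u w m = jFlatT S f m))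
    (hDROP : ∀ (k₀ : Type) [Field k₀] [CharP k₀ p] [PerfectField k₀]
      (S : Type) [CommRing S] [Algebra k₀ S] [Algebra.EssFiniteType k₀ S] [IsRegularLocalRing S]
      (f : S), ringKrullDim S ≤ 3 → f ≠ 0 → f ∈ (maximalIdeal S) ^ 2 →
      ∀ (P : Ideal S) [P.IsPrime], IsRegularLocalRing (S ⧸ P) → f ∈ P →
        topStratum iotaOrdEpsTau S f = {𝔮 | P ≤ 𝔮.asIdeal} →
        ∀ (n : ℕ) (u : Fin n → S) (w : Fin n → ℕ),
          Ideal.span (Set.range u) = maximalIdeal S → (maximalIdeal S).spanFinrank = n → (∃ i, 0 < w i) →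
          Ideal.span {x | ∃ i, 0 < w i ∧ x = u i} = P →
          (∀ m : ℕ, weightedMonomialIdeal u w m = jFlatT S f m) →
          WeightedDropHom iotaFlatT S f P u w) :
    PRungGrHomLE 3 p iotaFlatT jFlatT := by
  refine pRungGrHomLE_three_of_tieDescent_game p hD
    (canonicalGameClauseHomLE_three_of_weightedPresentation p fun k₀ _ _ _ S _ _ _ _ f hd hf0 hf2 P _ hreg hfP hE => ?_)
  obtain ⟨n, u, w, h1, h2, h3, h4, h5⟩ := hPRES k₀ S f hd hf0 hf2 P hreg hfP hE
  exact ⟨n, u, w, h1, h2, h3, h4, h5, hDROP k₀ S f hd hf0 hf2 P hreg hfP hE n u w h1 h2 h3 h4 h5⟩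

end Summit.ResolutionOfSingularities.ResolutionOfSingularities.Cruxes.HypersurfaceCentreConstruction.LocalEngine

end
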